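import Mathlib
import HarnessLib
import Summits.HubbardSuperconductivity.HubbardSuperconductivity.Theses.WeakCouplingBCS
import Summits.HubbardSuperconductivity.HubbardSuperconductivity.Theorems.WeakCouplingBCSKlCertB1gDopingWindowD010D020
import Summits.HubbardSuperconductivity.HubbardSuperconductivity.Theorems.WeakCouplingBCSWcbcsKohnLuttingerB1gKlCertForm
import Summits.HubbardSuperconductivity.HubbardSuperconductivity.Theorems.ChiralWindowCwThesisUFreeAnchor
import Summits.HubbardSuperconductivity.HubbardSuperconductivity.Theorems.WeakCouplingBCSH1TwoPointLimitKLScaleDPlumbing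

/-!
# Route `WeakCouplingBCS` — rung R2d: the ONSET leaf `H1TwoPointLimitKLOnsetD` implies the leaf of record
# `H1TwoPointLimitKLScaleD` on the certificate window `δ ∈ [0.10, 0.20]`, and the δ-form LOADED PAIR

Cell `gate-hubbard-kl`, seat `hubbard-kl-h1-p2` gen 2 (row «R2dH1 leaf → consumers; audit of the bridge hypotheses», LADDER-Hubbard
WORDING OF RECORD (ii); the two items left untried by seat `hubbard-kl-h1-p1`, `…Theorems.WeakCouplingBCSH1TwoPointLimitKLScaleDPlumbing`).
Write `ε₀ = squareDispersion 1 0`, `μ(δ) = chemicalPotentialOfDensity ε₀ (1-δ)`, `Λ_U(μ,χ) = channelInf ε₀ μ U χ`,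
`κ(δ) = -Λ_1(μ(δ), B1g)` (the `B1g` bottom of the second-order Kohn–Luttinger form at `U = 1`; the d-wave KL onset is
`β_KL = exp((2π)²/(κ(δ) U²))`).

§1 `klPair_doping_d010_d020` — the LOADED PAIR of rung R2d (LADDER §0 (D)) in the DOPING variable on the window of record
   `δ ∈ [0.10, 0.20]`, ONE set of constants `(U₀, c, γ)`: at every such `δ`, `B1g` leads every other `D₄` channel by `γU²` for
   `U ∈ (0, U₀)` AND the thermal two-point functions at `μ(δ)` converge for all `0 < U ≤ U₀`, `0 < β ≤ e^{c/U²}` — from the three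
   window enclosure records (cert form (A)) through `klb1g_doping_window_d010_d020` and the leaf through `R2dH1.control_certWindow`.
§2 `neg_channelInf_one_B1g_le_of_muWindow` — `κ` is BOUNDED ABOVE on the certified `μ`-window `[-0.42749, -0.1775]`
   UNCONDITIONALLY (continuity of `μ ↦ Λ_1(μ,B1g)` on the band, `klb1g_continuousOn_channelInf`, and compactness); no certified
   lower bound on `Λ_1(·, B1g)` is needed.  `channelInf_one_B1g_le_neg_gamma_of_records` — the records give the SIGN:
   `Λ_1(μ(δ), B1g) ≤ -γ < 0` on `[0.10, 0.20]` (`U²`-homogeneity `channelInf_sq_of_ne_A1g` + `stub_channelInfNonpos`).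
§3 `control_certWindow_of_onset_of_neg` / `control_certWindow_of_onset` — THE ARROW: the onset leaf
   `H1TwoPointLimitKLOnsetD` (stmt-HubbardSuperconductivity-19165; control for `β ≤ exp((1-η)(2π)²/(κ(δ)U²))`) implies the body of
   the leaf of record `H1TwoPointLimitKLScaleD` (stmt-19419; control for `β ≤ e^{c/U²}`, SOME `c > 0`) restricted to `[0.10, 0.20]`,
   modulo only `κ > 0` on the window (resp. modulo the records): with `κ ≤ K` one takes `c := (2π)²/(2K)` (`η = 1/2`).  So on the
   certificate window the onset leaf is the SHARPER closer (LADDER §0 (D) «sharper in scale, narrower in window» made a theorem).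
§4 `klOnsetPair_doping_d010_d020` / `klPair_doping_d010_d020_of_onset` — the loaded ONSET pair, and the loaded pair of §1 from
   the onset leaf instead of the leaf.

No definitions, no restatement of an item body (items consumed and produced BY NAME or by their verbatim bodies); folklore glue over
tree vocabulary.  Sources: S. Raghu, S. A. Kivelson, D. J. Scalapino, Phys. Rev. B 81 (2010) 224505, §II (7), (13), §III Fig. 2;
G. Benfatto, A. Giuliani, V. Mastropietro, Ann. Henri Poincaré 7 (2006) 809, Thm 1.1.
-/

noncomputable section

-- the tree's namespace `Summit.<Summit>.<Problem>.Theorems` repeats the summit name by design (D-0017)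
set_option linter.dupNamespace false

namespace Summit.HubbardSuperconductivity.HubbardSuperconductivity.Theorems.R2dH1

open Filter Set
open Literature.MathematicalPhysics.QuantumLattice Literature.Probability.LatticeModels
open Summit.HubbardSuperconductivity.HubbardSuperconductivity.Theses.WeakCouplingBCS
  (H1TwoPointLimitKLScaleD H1TwoPointLimitKLOnsetD WcbcsKohnLuttingerB1g)
open scoped Topology

/-! ### §1 The loaded pair in the doping variable on the window of record -/

/-- **The LOADED PAIR of rung R2d on the doping window of record `δ ∈ [0.10, 0.20]`, one set of constants.**  From the three
window enclosure records and the leaf `H1TwoPointLimitKLScaleD`: there are `U₀, c, γ > 0` such that for every `δ ∈ [0.10, 0.20]`,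
(selection) `Λ_U(μ(δ), B1g) + γU² ≤ Λ_U(μ(δ), χ)` for all `U ∈ (0, U₀)` and every `χ ≠ B1g`, and (control) the thermal two-point
functions of the Hubbard torus at `μ(δ)` converge as `L → ∞` for all `0 < U ≤ U₀`, `0 < β ≤ e^{c/U²}`.
[cite: RaghuKivelsonScalapino2010, §III Fig. 2] -/
theorem klPair_doping_d010_d020 (hA : klCertB1gWinA.EnclosuresB1g) (hB : klCertB1gWinB.EnclosuresB1g)
    (hC : klCertB1gWinC.EnclosuresB1g) (h : H1TwoPointLimitKLScaleD) :
    ∃ U₀ c γ : ℝ, 0 < U₀ ∧ 0 < c ∧ 0 < γ ∧ ∀ δ ∈ Set.Icc (0.10 : ℝ) 0.20,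
      (∀ U ∈ Set.Ioo (0 : ℝ) U₀, ∀ χ : D4Irrep, χ ≠ D4Irrep.B1g →
        channelInf (squareDispersion 1 0) (chemicalPotentialOfDensity (squareDispersion 1 0) (1 - δ)) U D4Irrep.B1g +
            γ * U ^ 2 ≤
          channelInf (squareDispersion 1 0) (chemicalPotentialOfDensity (squareDispersion 1 0) (1 - δ)) U χ) ∧
      (∀ U β : ℝ, 0 < U → U ≤ U₀ → 0 < β → β ≤ Real.exp (c / U ^ 2) →
        ∀ (x y : Site 2) (σ σ' : Fin 2), ∃ S : ℂ,
          Tendsto (fun L : ℕ => hubbardThermalTwoPoint β U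
            (chemicalPotentialOfDensity (squareDispersion 1 0) (1 - δ)) L x y σ σ') atTop (𝓝 S)) := by
  obtain ⟨U₀, c, hU₀, hc, H⟩ := control_certWindow h
  have hsel := klb1g_doping_window_d010_d020 hA hB hC
  have hγ : (0 : ℝ) < min (min ((klCertB1gWinA.gamma : ℚ) : ℝ) ((klCertB1gWinB.gamma : ℚ) : ℝ))
      ((klCertB1gWinC.gamma : ℚ) : ℝ) := by
    have h := klb1g_window_d010_d020_gamma_pos
    exact_mod_cast h
  refine ⟨min U₀ (1 / 2), c, _, lt_min hU₀ (by norm_num), hc, hγ, fun δ hδ => ⟨?_, ?_⟩⟩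
  · intro U hU χ hχ
    exact hsel δ hδ U ⟨hU.1, lt_of_lt_of_le hU.2 ((min_le_right _ _).trans (by norm_num))⟩ χ hχ
  · intro U β hU hUle
    exact H δ hδ U β hU (hUle.trans (min_le_left _ _))

/-! ### §2 The d-wave onset rate `κ(δ) = -Λ_1(μ(δ), B1g)` on the window: bounded above (unconditionally), positive (records) -/

/-- **`-Λ_1(μ, B1g)` is bounded above on the certified `μ`-window**, unconditionally: `μ ↦ channelInf ε₀ μ 1 B1g` is continuous
on the band `(-4, 0)` (`klb1g_continuousOn_channelInf`), hence bounded below on the compact sub-interval `[-0.42749, -0.1775]`.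
[folklore] -/
theorem neg_channelInf_one_B1g_le_of_muWindow :
    ∃ K : ℝ, 0 < K ∧ ∀ μ ∈ Set.Icc (-0.42749 : ℝ) (-0.1775),
      -channelInf (squareDispersion 1 0) μ 1 D4Irrep.B1g ≤ K := by
  have hsub : Set.Icc (-0.42749 : ℝ) (-0.1775) ⊆ Set.Ioo (-4 : ℝ) 0 := by
    intro μ hμ
    exact ⟨by linarith [hμ.1], by linarith [hμ.2]⟩
  have hcont : ContinuousOn (fun μ => channelInf (squareDispersion 1 0) μ 1 D4Irrep.B1g)
      (Set.Icc (-0.42749 : ℝ) (-0.1775)) :=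
    (klb1g_continuousOn_channelInf 1 D4Irrep.B1g).mono hsub
  obtain ⟨m, hm⟩ := isCompact_Icc.bddBelow_image hcont
  refine ⟨max (-m) 1, lt_of_lt_of_le one_pos (le_max_right _ _), fun μ hμ => ?_⟩
  have hle : m ≤ channelInf (squareDispersion 1 0) μ 1 D4Irrep.B1g := hm ⟨μ, hμ, rfl⟩
  exact le_trans (by linarith) (le_max_left _ _)

/-- **The onset rate is bounded above on the doping window of record**: there is `K > 0` with
`-channelInf ε₀ μ(δ) 1 B1g ≤ K` for every `δ ∈ [0.10, 0.20]` (`μ(δ) ∈ [-0.42749, -0.1775]`, `muOfDoping_mem_window_d010_d020`).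
[folklore] -/
theorem neg_channelInf_one_B1g_le_of_dopingWindow :
    ∃ K : ℝ, 0 < K ∧ ∀ δ ∈ Set.Icc (0.10 : ℝ) 0.20,
      -channelInf (squareDispersion 1 0) (chemicalPotentialOfDensity (squareDispersion 1 0) (1 - δ)) 1 D4Irrep.B1g ≤ K := by
  obtain ⟨K, hK, H⟩ := neg_channelInf_one_B1g_le_of_muWindow
  exact ⟨K, hK, fun δ hδ => H _ (muOfDoping_mem_window_d010_d020 δ hδ)⟩

/-- **The records give the sign of the `B1g` bottom on the window**: modulo the three window enclosure records,
`channelInf ε₀ μ(δ) 1 B1g ≤ -γ` with `γ = min (min γ_A γ_B) γ_C > 0`, for every `δ ∈ [0.10, 0.20]` — at `U = 1/2` the δ-form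
certificate gives `Λ_{1/2}(B1g) + γ/4 ≤ Λ_{1/2}(B2g) ≤ 0` (`stub_channelInfNonpos`), and `Λ_{1/2}(B1g) = Λ_1(B1g)/4`
(`channelInf_sq_of_ne_A1g`). [cite: RaghuKivelsonScalapino2010, §III Fig. 2] -/
theorem channelInf_one_B1g_le_neg_gamma_of_records (hA : klCertB1gWinA.EnclosuresB1g) (hB : klCertB1gWinB.EnclosuresB1g)
    (hC : klCertB1gWinC.EnclosuresB1g) :
    ∀ δ ∈ Set.Icc (0.10 : ℝ) 0.20,
      channelInf (squareDispersion 1 0) (chemicalPotentialOfDensity (squareDispersion 1 0) (1 - δ)) 1 D4Irrep.B1g ≤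
        -min (min ((klCertB1gWinA.gamma : ℚ) : ℝ) ((klCertB1gWinB.gamma : ℚ) : ℝ)) ((klCertB1gWinC.gamma : ℚ) : ℝ) := by
  intro δ hδ
  set m := chemicalPotentialOfDensity (squareDispersion 1 0) (1 - δ) with hm
  have hmI := muOfDoping_mem_window_d010_d020 δ hδ
  have hμ : m ∈ Set.Ioo (-4 : ℝ) 0 := ⟨by linarith [hmI.1], by linarith [hmI.2]⟩
  have hsel := klb1g_doping_window_d010_d020 hA hB hC δ hδ (1 / 2) ⟨by norm_num, by norm_num⟩ D4Irrep.B2g (by decide)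
  have hnonpos : channelInf (squareDispersion 1 0) m (1 / 2) D4Irrep.B2g ≤ 0 := CwThesis.stub_channelInfNonpos (1 / 2) D4Irrep.B2g hμ
  have hsq := CwThesis.channelInf_sq_of_ne_A1g hμ (1 / 2) (show D4Irrep.B1g ≠ D4Irrep.A1g by decide)
  rw [← hm] at hsel
  rw [hsq] at hsel
  nlinarith

/-- **The onset rate is positive on the window (records)**: `0 < γ ≤ -channelInf ε₀ μ(δ) 1 B1g` for `δ ∈ [0.10, 0.20]`.
[cite: RaghuKivelsonScalapino2010, §III Fig. 2] -/
theorem neg_channelInf_one_B1g_pos_of_records (hA : klCertB1gWinA.EnclosuresB1g) (hB : klCertB1gWinB.EnclosuresB1g)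
    (hC : klCertB1gWinC.EnclosuresB1g) :
    ∀ δ ∈ Set.Icc (0.10 : ℝ) 0.20,
      0 < -channelInf (squareDispersion 1 0) (chemicalPotentialOfDensity (squareDispersion 1 0) (1 - δ)) 1 D4Irrep.B1g := by
  intro δ hδ
  have h := channelInf_one_B1g_le_neg_gamma_of_records hA hB hC δ hδ
  have hγ : (0 : ℝ) < min (min ((klCertB1gWinA.gamma : ℚ) : ℝ) ((klCertB1gWinB.gamma : ℚ) : ℝ))
      ((klCertB1gWinC.gamma : ℚ) : ℝ) := by
    have h := klb1g_window_d010_d020_gamma_pos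
    exact_mod_cast h
  linarith

/-! ### §3 The arrow: onset leaf ⇒ leaf of record on the certificate window -/

/-- **ONSET LEAF ⇒ LEAF on `[0.10, 0.20]`, modulo the sign of the `B1g` bottom.**  If `κ(δ) = -channelInf ε₀ μ(δ) 1 B1g > 0` on
the window, the onset leaf `H1TwoPointLimitKLOnsetD` (control of the thermal two-point functions for all
`0 < β ≤ exp((1-η)(2π)²/(κ(δ)U²))`, every `η ∈ (0,1)`) implies the body of the leaf of record restricted to the window: control for
all `0 < β ≤ e^{c/U²}` with ONE `c > 0` — namely `c = (2π)²/(2K)` for any bound `κ ≤ K` on the window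
(`neg_channelInf_one_B1g_le_of_dopingWindow`, `η = 1/2`), since then `c/U² ≤ (1 - 1/2)(2π)²/(κ(δ)U²)`. [folklore] -/
theorem control_certWindow_of_onset_of_neg
    (hneg : ∀ δ ∈ Set.Icc (0.10 : ℝ) 0.20,
      0 < -channelInf (squareDispersion 1 0) (chemicalPotentialOfDensity (squareDispersion 1 0) (1 - δ)) 1 D4Irrep.B1g)
    (hon : H1TwoPointLimitKLOnsetD) :
    ∃ U₀ c : ℝ, 0 < U₀ ∧ 0 < c ∧ ∀ δ ∈ Set.Icc (0.10 : ℝ) 0.20, ∀ U β : ℝ, 0 < U → U ≤ U₀ → 0 < β →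
      β ≤ Real.exp (c / U ^ 2) → ∀ (x y : Site 2) (σ σ' : Fin 2), ∃ S : ℂ,
        Tendsto (fun L : ℕ => hubbardThermalTwoPoint β U
          (chemicalPotentialOfDensity (squareDispersion 1 0) (1 - δ)) L x y σ σ') atTop (𝓝 S) := by
  obtain ⟨K, hK, hKb⟩ := neg_channelInf_one_B1g_le_of_dopingWindow
  obtain ⟨U₀, hU₀, H⟩ := hon (1 / 2) (by norm_num) (by norm_num)
  refine ⟨U₀, (2 * Real.pi) ^ 2 / (2 * K), hU₀, by positivity, ?_⟩
  intro δ hδ U β hU hUle hβ hβle x y σ σ'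
  refine H δ hδ U β hU hUle hβ (hβle.trans (Real.exp_le_exp.2 ?_)) x y σ σ'
  set κ : ℝ := -channelInf (squareDispersion 1 0) (chemicalPotentialOfDensity (squareDispersion 1 0) (1 - δ)) 1 D4Irrep.B1g
    with hκ
  have hκpos : 0 < κ := hneg δ hδ
  have hκK : κ ≤ K := hKb δ hδ
  have hU2 : 0 < U ^ 2 := by positivity
  have hpi : 0 < (2 * Real.pi) ^ 2 := by positivity
  rw [div_le_div_iff₀ (by positivity) (by positivity)]
  -- `(2π)²/(2K) · (κ U²) = (2π)² U² · κ/(2K) ≤ (2π)² U² · (1/2)` since `κ ≤ K`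
  have h1 : (2 * Real.pi) ^ 2 / (2 * K) * (κ * U ^ 2) = ((2 * Real.pi) ^ 2 * U ^ 2) * (κ / (2 * K)) := by ring
  have h2 : κ / (2 * K) ≤ 1 / 2 := by
    rw [div_le_iff₀ (by positivity)]
    linarith
  rw [h1]
  have h3 : 0 ≤ (2 * Real.pi) ^ 2 * U ^ 2 := by positivity
  nlinarith [mul_le_mul_of_nonneg_left h2 h3]

/-- **ONSET LEAF ⇒ LEAF on `[0.10, 0.20]`, modulo the three window enclosure records** (which supply the sign `κ > 0`,
`neg_channelInf_one_B1g_pos_of_records`): on the certificate window of rung R2d the onset leaf `H1TwoPointLimitKLOnsetD`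
(stmt-HubbardSuperconductivity-19165) is the SHARPER closer — it implies the body of `H1TwoPointLimitKLScaleD` there.
[cite: RaghuKivelsonScalapino2010, §III Fig. 2] -/
theorem control_certWindow_of_onset (hA : klCertB1gWinA.EnclosuresB1g) (hB : klCertB1gWinB.EnclosuresB1g)
    (hC : klCertB1gWinC.EnclosuresB1g) (hon : H1TwoPointLimitKLOnsetD) :
    ∃ U₀ c : ℝ, 0 < U₀ ∧ 0 < c ∧ ∀ δ ∈ Set.Icc (0.10 : ℝ) 0.20, ∀ U β : ℝ, 0 < U → U ≤ U₀ → 0 < β →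
      β ≤ Real.exp (c / U ^ 2) → ∀ (x y : Site 2) (σ σ' : Fin 2), ∃ S : ℂ,
        Tendsto (fun L : ℕ => hubbardThermalTwoPoint β U
          (chemicalPotentialOfDensity (squareDispersion 1 0) (1 - δ)) L x y σ σ') atTop (𝓝 S) :=
  control_certWindow_of_onset_of_neg (neg_channelInf_one_B1g_pos_of_records hA hB hC) hon

/-! ### §4 The loaded ONSET pair, and the loaded pair from the onset leaf -/

/-- **The loaded ONSET pair on `[0.10, 0.20]`** (records + onset leaf): for every `η ∈ (0,1)` there are `U₀, γ > 0` such that at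
every `δ ∈ [0.10, 0.20]`: `B1g` leads by `γU²` for `U ∈ (0, U₀)`, the onset rate `κ(δ) = -channelInf ε₀ μ(δ) 1 B1g` satisfies
`γ ≤ κ(δ)`, and the thermal two-point functions at `μ(δ)` converge for all `0 < U ≤ U₀` and
`0 < β ≤ exp((1-η)(2π)²/(κ(δ)U²))` — control down to the fraction `1-η` (log scale) of the certified d-wave onset.
[cite: RaghuKivelsonScalapino2010, §II (13), §III Fig. 2] -/
theorem klOnsetPair_doping_d010_d020 (hA : klCertB1gWinA.EnclosuresB1g) (hB : klCertB1gWinB.EnclosuresB1g)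
    (hC : klCertB1gWinC.EnclosuresB1g) (hon : H1TwoPointLimitKLOnsetD) :
    ∀ η : ℝ, 0 < η → η < 1 → ∃ U₀ γ : ℝ, 0 < U₀ ∧ 0 < γ ∧ ∀ δ ∈ Set.Icc (0.10 : ℝ) 0.20,
      (∀ U ∈ Set.Ioo (0 : ℝ) U₀, ∀ χ : D4Irrep, χ ≠ D4Irrep.B1g →
        channelInf (squareDispersion 1 0) (chemicalPotentialOfDensity (squareDispersion 1 0) (1 - δ)) U D4Irrep.B1g +
            γ * U ^ 2 ≤
          channelInf (squareDispersion 1 0) (chemicalPotentialOfDensity (squareDispersion 1 0) (1 - δ)) U χ) ∧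
      γ ≤ -channelInf (squareDispersion 1 0) (chemicalPotentialOfDensity (squareDispersion 1 0) (1 - δ)) 1 D4Irrep.B1g ∧
      (∀ U β : ℝ, 0 < U → U ≤ U₀ → 0 < β →
        β ≤ Real.exp ((1 - η) * (2 * Real.pi) ^ 2 /
          ((-channelInf (squareDispersion 1 0) (chemicalPotentialOfDensity (squareDispersion 1 0) (1 - δ)) 1
              D4Irrep.B1g) * U ^ 2)) →
        ∀ (x y : Site 2) (σ σ' : Fin 2), ∃ S : ℂ,
          Tendsto (fun L : ℕ => hubbardThermalTwoPoint β U
            (chemicalPotentialOfDensity (squareDispersion 1 0) (1 - δ)) L x y σ σ') atTop (𝓝 S)) := by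
  intro η hη hη1
  obtain ⟨U₀, hU₀, H⟩ := hon η hη hη1
  have hsel := klb1g_doping_window_d010_d020 hA hB hC
  have hsign := channelInf_one_B1g_le_neg_gamma_of_records hA hB hC
  have hγ : (0 : ℝ) < min (min ((klCertB1gWinA.gamma : ℚ) : ℝ) ((klCertB1gWinB.gamma : ℚ) : ℝ))
      ((klCertB1gWinC.gamma : ℚ) : ℝ) := by
    have h := klb1g_window_d010_d020_gamma_pos
    exact_mod_cast h
  refine ⟨min U₀ (1 / 2), _, lt_min hU₀ (by norm_num), hγ, fun δ hδ => ⟨?_, ?_, ?_⟩⟩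
  · intro U hU χ hχ
    exact hsel δ hδ U ⟨hU.1, lt_of_lt_of_le hU.2 ((min_le_right _ _).trans (by norm_num))⟩ χ hχ
  · have := hsign δ hδ
    linarith
  · intro U β hU hUle
    exact H δ hδ U β hU (hUle.trans (min_le_left _ _))

/-- **The loaded pair of §1 from the ONSET leaf** (records + `H1TwoPointLimitKLOnsetD` instead of `H1TwoPointLimitKLScaleD`):
same conclusion as `klPair_doping_d010_d020`. [cite: RaghuKivelsonScalapino2010, §III Fig. 2] -/
theorem klPair_doping_d010_d020_of_onset (hA : klCertB1gWinA.EnclosuresB1g) (hB : klCertB1gWinB.EnclosuresB1g)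
    (hC : klCertB1gWinC.EnclosuresB1g) (hon : H1TwoPointLimitKLOnsetD) :
    ∃ U₀ c γ : ℝ, 0 < U₀ ∧ 0 < c ∧ 0 < γ ∧ ∀ δ ∈ Set.Icc (0.10 : ℝ) 0.20,
      (∀ U ∈ Set.Ioo (0 : ℝ) U₀, ∀ χ : D4Irrep, χ ≠ D4Irrep.B1g →
        channelInf (squareDispersion 1 0) (chemicalPotentialOfDensity (squareDispersion 1 0) (1 - δ)) U D4Irrep.B1g +
            γ * U ^ 2 ≤
          channelInf (squareDispersion 1 0) (chemicalPotentialOfDensity (squareDispersion 1 0) (1 - δ)) U χ) ∧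
      (∀ U β : ℝ, 0 < U → U ≤ U₀ → 0 < β → β ≤ Real.exp (c / U ^ 2) →
        ∀ (x y : Site 2) (σ σ' : Fin 2), ∃ S : ℂ,
          Tendsto (fun L : ℕ => hubbardThermalTwoPoint β U
            (chemicalPotentialOfDensity (squareDispersion 1 0) (1 - δ)) L x y σ σ') atTop (𝓝 S)) := by
  obtain ⟨U₀, c, hU₀, hc, H⟩ := control_certWindow_of_onset hA hB hC hon
  have hsel := klb1g_doping_window_d010_d020 hA hB hC
  have hγ : (0 : ℝ) < min (min ((klCertB1gWinA.gamma : ℚ) : ℝ) ((klCertB1gWinB.gamma : ℚ) : ℝ))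
      ((klCertB1gWinC.gamma : ℚ) : ℝ) := by
    have h := klb1g_window_d010_d020_gamma_pos
    exact_mod_cast h
  refine ⟨min U₀ (1 / 2), c, _, lt_min hU₀ (by norm_num), hc, hγ, fun δ hδ => ⟨?_, ?_⟩⟩
  · intro U hU χ hχ
    exact hsel δ hδ U ⟨hU.1, lt_of_lt_of_le hU.2 ((min_le_right _ _).trans (by norm_num))⟩ χ hχ
  · intro U β hU hUle
    exact H δ hδ U β hU (hUle.trans (min_le_left _ _))

end Summit.HubbardSuperconductivity.HubbardSuperconductivity.Theorems.R2dH1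

end
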